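import Literature.AlgebraicGeometry.Motives.HodgeLieCentreRationalTensors
import Literature.AlgebraicGeometry.Motives.ExtendedMumfordTateGroup
import Literature.AlgebraicGeometry.Motives.ZarhinHodgeGroupLieAlgebra
import Literature.FieldTheory.AlgClosed.AutStableSubspaceDescent
import HarnessLib

/-!
# Galois descent for the centre of the Hodge Lie algebra: an `Aut(ℂ)`-stable subspace of `T^{a,0}_ℂ` killed by `Θ` is killed by `𝔥`,
# and the determinant tensors of a Hodge endomorphism give `Σ_λ w_λ tr(y|V_λ) = 0` (Deligne 1982, I Prop. 3.4, Ex. 3.7 (c), §5)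

Family `hodge`, layer `Literature/AlgebraicGeometry/Motives`.  THEOREMS ONLY (no definition, no named fact).  Written for the
cell `pub-hodgecm2` (COR-CM), seat `b27` gen 55 (count-neutral Mumford–Tate-rank ladder, «the centre», part 4b: the engine).

`H` a pure `ℚ`-Hodge structure of weight `n` on a finite-dimensional `V`; `𝔥 = H.hodgeLie` (`Motives/ZarhinHodgeGroupLieAlgebra`:
the rational endomorphisms whose derivation action `ρ` kills every Hodge tensor); `V_ℂ = ℂ ⊗ V`; `T^{a,0}_ℂ = V_ℂ^{⊗a} ⊗ (V_ℂ^∨)^{⊗0}`.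

* §1 `piTensorDerivation_tprod_of_diag` — `ρ(Y)(⊗ vᵢ) = (Σ dᵢ) ⊗ vᵢ` if `Y vᵢ = dᵢ vᵢ`.
* §2 **`tensorDerivation_baseChange_eq_zero_of_coordConj_stable`** — GALOIS DESCENT: if a complex subspace `D ⊆ T^{a,0}_ℂ` is stable
  under coordinate conjugation by every `τ ∈ Aut(ℂ)` in a rational tensor basis and is killed by `ρ(Θ)` for an operator `Θ` diagonal
  with eigenvalues `2p − n` on a basis of `V_ℂ` subordinate to the Hodge decomposition, then `ρ(y_ℂ)` kills `D` for every `y ∈ 𝔥`.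
  PROOF: `D` is spanned by tensors with rational coordinates (the tree's `Complex.submodule_le_span_fixed_of_forall_ringEquiv`,
  `FieldTheory/AlgClosed/AutStableSubspaceDescent`: «enough automorphisms of `ℂ`»), these are complexifications `ι s` of rational
  tensors (`exists_tensorSpaceToBaseChange_eq_of_repr_mem_range`), `ρ(Θ) ι s = 0` puts `ι s` in the span of the tensor basis vectors of
  total degree `p`, `2p = an` (or forces `s = 0`), so `s` is a Hodge class of type `(p,p)` and `ρ(y) s = 0` by definition of `𝔥`.
  This is Deligne's «`t` is of type `(0,0)` iff it is fixed by `μ(𝔾_m)`» plus «defined over `ℚ`» (LNM 900, I Prop. 3.4) in Lie form.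
* §3 `piTensorDerivation_theta_antisym_tprod_eq_zero` — for a Hodge-adapted eigenbasis `e_k ∈ Eig_{wt k}(z_ℂ) ∩ V^{deg k, n−deg k}`
  of a rational endomorphism `z`, multiplicities `w : ℂ → ℕ` with `Σ_k w(ρ⁻¹ wt k)(2 deg k − n) = 0` for all `ρ ∈ Aut(ℂ)`, slots
  `(k, j)`, `j < w(wt k)`, grouped by `(wt k, j)`, and the group antisymmetriser `A` of part 1: `ρ(Θ) A(⊗ᵢ xᵢ) = 0` whenever
  `xᵢ ∈ Eig_{ρ(wt kᵢ)}(z_ℂ)` (expand in the basis: non-injective indices die by alternation, injective ones fill whole blocks —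
  `dim Eig_{ρλ} = dim Eig_λ`, part 2 — and have total `Θ`-degree `Σ_λ w_λ μ(ρλ) = 0`, the slot count of part 4a).
* §4 `coordConj_mem_span_antisym` — the span `D` of these `A(⊗ᵢ xᵢ) ⊗ u₀` (all `ρ`) is stable under coordinate conjugation.
* §5 **`sum_mul_repr_baseChange_eq_zero_of_mem_hodgeLie`** — THE ENGINE: for every `y ∈ 𝔥` commuting with `z`,
  `Σ_k w(wt k) · e^*_k(y_ℂ e_k) = 0`, i.e. `Σ_λ w_λ tr(y_ℂ|V_λ) = 0`: the determinant tensor `t_w = A(⊗ᵢ e_{kᵢ}) ⊗ u₀ ∈ D` is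
  killed by `ρ(y_ℂ)` (§2–§4) and `ρ(y_ℂ) t_w = (Σᵢ e^*_{kᵢ}(y_ℂ e_{kᵢ})) t_w`, `t_w ≠ 0` (part 1) — Deligne's «`Y(G)` is the Galois
  module generated by `μ`» (Ex. 3.7 (c)) / «`G_ℂ` is generated by the `σμ(𝔾_m)`» (§5), for the centre, on the Lie algebra.

## References
* [Deligne1982HodgeCycles] P. Deligne, *Hodge cycles on abelian varieties*, LNM 900 (1982), I §3 Prop. 3.4 (and proof), Ex. 3.7 (c), §5.
  [cite: Deligne1982HodgeCycles, I §3 Prop. 3.4, Example 3.7 (c) and §5]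
* [MoonenZarhin1999LowDim] B. Moonen, Yu. G. Zarhin, Math. Ann. 315 (1999), §3 (3.1). [cite: MoonenZarhin1999LowDim, §3 (3.1)]
* [Borel1991] A. Borel, *Linear Algebraic Groups*, 2nd ed. (1991), AG §14.1–14.2 (`k`-structures, descent of subspaces). [cite: Borel1991, AG §14.2]
-/

noncomputable section

open scoped TensorProduct PiTensorProduct
open Cardinal
namespace Literature.AlgebraicGeometry.Motives

universe u

/-! ### §1 The derivation action of a diagonal operator on a pure tensor -/

/-- `ρ(Y)(⊗ᵢ vᵢ) = (Σᵢ dᵢ) · ⊗ᵢ vᵢ` when `Y vᵢ = dᵢ vᵢ`. [cite: Deligne1982HodgeCycles, I §3 Prop. 3.4, Example 3.7 (c) and §5] -/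
theorem piTensorDerivation_tprod_of_diag {K : Type*} [Field K] {W : Type*} [AddCommGroup W] [Module K W] {a : ℕ}
    (Y : Module.End K W) (v : Fin a → W) (d : Fin a → K) (hv : ∀ i, Y (v i) = d i • v i) :
    piTensorDerivation a Y (PiTensorProduct.tprod K v) = (∑ i, d i) • PiTensorProduct.tprod K v := by
  classical
  rw [piTensorDerivation_tprod, Finset.sum_smul]
  refine Finset.sum_congr rfl fun i _ => ?_
  rw [hv, MultilinearMap.map_update_smul, Function.update_eq_self]

namespace HodgeStructure

variable {V : Type u} [AddCommGroup V] [Module ℚ V] [Module.Finite ℚ V] [HodgeTensorFacts.{u, u}] {n : ℤ}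

/-! ### §2 Galois descent: an `Aut(ℂ)`-stable subspace of `T^{a,0}_ℂ` killed by `Θ` is killed by the Hodge Lie algebra -/

/-- **Galois descent for Hodge tensors.**  `e_k ∈ V^{deg k, n − deg k}` a basis of `V_ℂ` subordinate to the Hodge decomposition,
`Θ` the operator `Θ e_k = (2 deg k − n) e_k`, `b` a `ℚ`-basis of `V`, `D ⊆ T^{a,0}_ℂ` a complex subspace which is (i) stable under
coordinate conjugation `𝓒[τ]` by every `τ ∈ Aut(ℂ)` in the rational tensor basis on `1 ⊗ b` and (ii) killed by `ρ(Θ)`.  Then `ρ(y_ℂ)`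
kills `D` for every `y` in the Hodge Lie algebra: `D` is spanned by complexifications of RATIONAL tensors (enough automorphisms of `ℂ`),
and a rational tensor killed by `ρ(Θ)` is a Hodge class of type `(p,p)`, `2p = an`.
[cite: Deligne1982HodgeCycles, I §3 Prop. 3.4, Example 3.7 (c) and §5] [cite: Borel1991, AG §14.2] -/
theorem tensorDerivation_baseChange_eq_zero_of_coordConj_stable (H : HodgeStructure V n) {N : ℕ}
    (e : Module.Basis (Fin N) ℂ (ℂ ⊗[ℚ] V)) (deg : Fin N → ℤ) (hep : ∀ k, e k ∈ H.piece (deg k) (n - deg k))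
    (Θ : Module.End ℂ (ℂ ⊗[ℚ] V)) (hΘ : ∀ k, Θ (e k) = ((2 * deg k - n : ℤ) : ℂ) • e k)
    {ι : Type*} [Fintype ι] [DecidableEq ι] (b : Module.Basis ι ℚ V) {a : ℕ}
    (D : Submodule ℂ (hodgeTensorSpaceOver ℂ (ℂ ⊗[ℚ] V) a 0))
    (hstab : ∀ (τ : ℂ ≃+* ℂ), ∀ T ∈ D,
      ((Module.Basis.repr (hodgeTensorBasis (Algebra.TensorProduct.basis ℂ b) a 0)).toAddEquiv.trans
        ((Finsupp.mapRange.addEquiv (RingEquiv.toAddEquiv (τ))).trans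
          (Module.Basis.repr (hodgeTensorBasis (Algebra.TensorProduct.basis ℂ b) a 0)).toAddEquiv.symm)) T ∈ D)
    (hΘD : ∀ T ∈ D, tensorDerivation a 0 Θ T = 0) {y : Module.End ℚ V} (hy : y ∈ H.hodgeLie) :
    ∀ T ∈ D, tensorDerivation a 0 (y.baseChange ℂ) T = 0 := by
  classical
  -- the rational tensor basis, the coordinate map, the countable subfield `ℚ ⊆ ℂ`
  set E0 := hodgeTensorBasis (Algebra.TensorProduct.basis ℂ b) a 0 with hE0
  set c : hodgeTensorSpaceOver ℂ (ℂ ⊗[ℚ] V) a 0 →ₗ[ℂ] ((Fin a → ι) × (Fin 0 → ι) → ℂ) :=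
    (Finsupp.linearEquivFunOnFinite ℂ ℂ ((Fin a → ι) × (Fin 0 → ι))).toLinearMap ∘ₗ E0.repr.toLinearMap with hc
  have hc_apply : ∀ T x, c T x = E0.repr T x := fun T x => rfl
  have hc_inj : Function.Injective c := by
    intro T T' h
    apply E0.repr.injective
    ext x
    rw [← hc_apply, ← hc_apply, h]
  set F : Subfield ℂ := (algebraMap ℚ ℂ).fieldRange with hF
  have hFcount : #F ≤ ℵ₀ := by
    rw [Cardinal.mk_le_aleph0_iff]
    have hsurj : Function.Surjective fun q : ℚ => (⟨algebraMap ℚ ℂ q, RingHom.mem_fieldRange.2 ⟨q, rfl⟩⟩ : F) := by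
      rintro ⟨x, hx⟩
      obtain ⟨q, rfl⟩ := RingHom.mem_fieldRange.1 hx
      exact ⟨q, rfl⟩
    exact hsurj.countable
  -- the coordinate image of `D` is `Aut(ℂ)`-stable
  set Vc : Submodule ℂ ((Fin a → ι) × (Fin 0 → ι) → ℂ) := D.map c with hVc
  have hVc_stab : ∀ ρ : ℂ ≃+* ℂ, (∀ x ∈ F, ρ x = x) → ∀ v ∈ Vc, (⇑ρ ∘ v) ∈ Vc := by
    intro ρ _ v hv
    obtain ⟨T, hT, rfl⟩ := Submodule.mem_map.1 hv
    refine Submodule.mem_map.2 ⟨_, hstab ρ T hT, ?_⟩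
    funext x
    rw [hc_apply, Function.comp_apply, hc_apply, hE0, repr_coordConj']
  have hdesc := Literature.FieldTheory.AlgClosed.Complex.submodule_le_span_fixed_of_forall_ringEquiv F hFcount Vc hVc_stab
  -- a rational-coordinate member of `Vc` is `c (ι s)` for a rational tensor `s ∈ T^{a,0}` with `ι s ∈ D`, and `ρ(y_ℂ) (ι s) = 0`
  set Ky : Submodule ℂ (hodgeTensorSpaceOver ℂ (ℂ ⊗[ℚ] V) a 0) := LinearMap.ker (tensorDerivation a 0 (y.baseChange ℂ)) with hKy
  -- the graded basis in universe `u` and the span criterion for the kernel of `ρ(Θ)`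
  set e' : Module.Basis (ULift.{u} (Fin N)) ℂ (ℂ ⊗[ℚ] V) := e.reindex Equiv.ulift.symm with he'
  have he'_apply : ∀ k : ULift.{u} (Fin N), e' k = e k.down := fun k => by
    rw [he', Module.Basis.reindex_apply, Equiv.symm_symm, Equiv.ulift_apply]
  have hF' : ∀ q, H.F q = Submodule.span ℂ (e' '' {k | q ≤ deg k.down}) := fun q =>
    F_eq_span_of_basis_mem_piece H e' (fun k => deg k.down) (fun k => by rw [he'_apply]; exact hep k.down) q
  have hΘ' : ∀ k : ULift.{u} (Fin N), Θ (e' k) = ((2 * deg k.down - n : ℤ) : ℂ) • e' k := fun k => by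
    rw [he'_apply, hΘ]
  have hrat : ∀ v ∈ Vc, (∀ x, v x ∈ F) → v ∈ Ky.map c := by
    intro v hv hvF
    obtain ⟨T, hTD, rfl⟩ := Submodule.mem_map.1 hv
    -- `T = ι s`
    have hcoords : ∀ x, E0.repr T x ∈ Set.range (algebraMap ℚ ℂ) := fun x => by
      have h := hvF x
      rw [hc_apply, hF, RingHom.mem_fieldRange] at h
      exact h
    obtain ⟨s, hs⟩ := exists_tensorSpaceToBaseChange_eq_of_repr_mem_range b T hcoords
    refine Submodule.mem_map.2 ⟨T, ?_, rfl⟩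
    rw [hKy, LinearMap.mem_ker, ← hs, tensorDerivation_baseChange_tensorSpaceToBaseChange]
    -- `ρ(Θ) (ι s) = 0` puts `ι s` in the span of the degree-`p` tensor basis vectors
    have hΘs : tensorDerivation a 0 Θ (tensorSpaceToBaseChange ℂ V a 0 s) = 0 := by rw [hs]; exact hΘD T hTD
    set dfun : (Fin a → ULift.{u} (Fin N)) × (Fin 0 → ULift.{u} (Fin N)) → ℂ := fun x =>
      (∑ k, (((2 * deg (x.1 k).down - n : ℤ) : ℂ))) - ∑ l, (((2 * deg (x.2 l).down - n : ℤ) : ℂ)) with hdfun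
    have hdiag : ∀ x : (Fin a → ULift.{u} (Fin N)) × (Fin 0 → ULift.{u} (Fin N)),
        tensorDerivation a 0 Θ (hodgeTensorBasis e' a 0 x) = dfun x • hodgeTensorBasis e' a 0 x :=
      fun x => tensorDerivation_hodgeTensorBasis' e' hΘ' x
    have hker : tensorSpaceToBaseChange ℂ V a 0 s ∈ Submodule.span ℂ (hodgeTensorBasis e' a 0 '' {x | dfun x = 0}) := by
      rw [← @ker_eq_span_of_diag ℂ _ (hodgeTensorSpaceOver ℂ (ℂ ⊗[ℚ] V) a 0) _ _ _ (hodgeTensorBasis e' a 0)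
        (tensorDerivation a 0 Θ) dfun hdiag _]
      exact hΘs
    have hsum0 : ∀ x : (Fin a → ULift.{u} (Fin N)) × (Fin 0 → ULift.{u} (Fin N)),
        dfun x = 0 ↔ 2 * tensorDegree (fun k : ULift.{u} (Fin N) => deg k.down) x = (a : ℤ) * n := by
      intro x
      rw [hdfun]
      dsimp only
      rw [Finset.sum_of_isEmpty (s := (Finset.univ : Finset (Fin 0))), sub_zero, tensorDegree_apply,
        Finset.sum_of_isEmpty (s := (Finset.univ : Finset (Fin 0))), sub_zero]
      have hcast : (∑ k, (((2 * deg (x.1 k).down - n : ℤ) : ℂ))) = (((∑ k, (2 * deg (x.1 k).down - n) : ℤ)) : ℂ) := by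
        push_cast; rfl
      rw [hcast, Int.cast_eq_zero, Finset.sum_sub_distrib, Finset.sum_const, Finset.card_univ, Fintype.card_fin,
        nsmul_eq_mul, ← Finset.mul_sum, sub_eq_zero]
    by_cases hp : ∃ p : ℤ, (a : ℤ) * n = 2 * p
    · obtain ⟨p, hp⟩ := hp
      have hmem : tensorSpaceToBaseChange ℂ V a 0 s ∈ Submodule.span ℂ (hodgeTensorBasis e' a 0 ''
          {x | tensorDegree (fun k : ULift.{u} (Fin N) => deg k.down) x = p}) := by
        refine Submodule.span_mono (Set.image_mono fun x hx => ?_) hker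
        simp only [Set.mem_setOf_eq] at hx ⊢
        have h2 := (hsum0 x).1 hx
        omega
      have hcls : s ∈ (H.tensorSpace a 0).hodgeClasses p := mem_hodgeClasses_of_mem_span_degree H e' hF' hmem
      have h0 : tensorDerivation a 0 y s = 0 :=
        (H.mem_hodgeLie_iff y).1 hy a 0 p (by push_cast; linarith) s hcls
      rw [h0, map_zero]
    · -- `a n` odd: no tensor basis vector has `Θ`-degree zero, so `ι s = 0`
      have hempty : {x : (Fin a → ULift.{u} (Fin N)) × (Fin 0 → ULift.{u} (Fin N)) | dfun x = 0} = ∅ := by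
        ext x
        simp only [Set.mem_setOf_eq, Set.mem_empty_iff_false, iff_false]
        intro hx
        exact hp ⟨_, ((hsum0 x).1 hx).symm⟩
      rw [hempty, Set.image_empty, Submodule.span_empty, Submodule.mem_bot] at hker
      have hs0 : s = 0 := by
        apply (hodgeTensorBasis b a 0).ext_elem
        intro x
        have h := repr_tensorSpaceToBaseChange (K := ℂ) (V := V) b a 0 s x
        rw [hker, map_zero, Finsupp.zero_apply] at h
        rw [map_zero, Finsupp.zero_apply]
        exact (map_eq_zero_iff (algebraMap ℚ ℂ) (algebraMap ℚ ℂ).injective).1 h.symm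
      rw [hs0, map_zero, map_zero]
  -- conclusion: every `T ∈ D` lies in the kernel of `ρ(y_ℂ)`
  intro T hT
  have hcT : c T ∈ Submodule.span ℂ {w : (Fin a → ι) × (Fin 0 → ι) → ℂ | w ∈ Vc ∧ ∀ x, w x ∈ F} :=
    hdesc (Submodule.mem_map.2 ⟨T, hT, rfl⟩)
  have hle : Submodule.span ℂ {w : (Fin a → ι) × (Fin 0 → ι) → ℂ | w ∈ Vc ∧ ∀ x, w x ∈ F} ≤ Ky.map c :=
    Submodule.span_le.2 fun w hw => hrat w hw.1 hw.2
  obtain ⟨T', hT', hTT'⟩ := Submodule.mem_map.1 (hle hcT)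
  rw [← hc_inj hTT']
  exact hT'

/-! ### §3 The determinant tensors of a Hodge endomorphism are killed by `Θ` (all Galois translates) -/

section Engine

variable (H : HodgeStructure V n) {z : Module.End ℚ V} {N : ℕ} (e : Module.Basis (Fin N) ℂ (ℂ ⊗[ℚ] V))
  (wt : Fin N → ℂ) (deg : Fin N → ℤ)
  (he : ∀ k, e k ∈ Module.End.eigenspace (z.baseChange ℂ) (wt k) ⊓ H.piece (deg k) (n - deg k))
  (w : ℂ → ℕ) (hw : ∀ ρ : ℂ ≃+* ℂ, ∑ k, (w (ρ.symm (wt k)) : ℤ) * (2 * deg k - n) = 0)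
  {a : ℕ} (ε : Fin a ≃ Σ k : Fin N, Fin (w (wt k)))
  (A : Module.End ℂ (⨂[ℂ]^a (ℂ ⊗[ℚ] V)))
  (hA : A = ∑ π ∈ Finset.univ.filter (fun π : Equiv.Perm (Fin a) =>
      ∀ i, (wt (ε (π i)).1, ((ε (π i)).2 : ℕ)) = (wt (ε i).1, ((ε i).2 : ℕ))),
    ((Equiv.Perm.sign π : ℤ) : ℂ) • (PiTensorProduct.reindex ℂ (fun _ : Fin a => ℂ ⊗[ℚ] V) π).toLinearMap)

include he hw hA in
omit [HodgeTensorFacts.{u, u}] in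
/-- **`ρ(Θ)` kills `A(⊗ᵢ xᵢ)` whenever `xᵢ ∈ Eig_{ρ(wt kᵢ)}(z_ℂ)`**, for the slots `i ↔ (kᵢ, jᵢ)`, `jᵢ < w(wt kᵢ)`, grouped by
`(wt kᵢ, jᵢ)`: expanding in the adapted basis, an index either misses the blocks (coefficient `0`), or repeats a basis vector inside a
group (alternation), or fills every block `ρλ` exactly `w_λ` times (slot count) and then has `Θ`-degree `Σ_λ w_λ μ(ρλ) = 0`.
[cite: Deligne1982HodgeCycles, I §3 Prop. 3.4, Example 3.7 (c) and §5] -/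
theorem piTensorDerivation_theta_antisym_tprod_eq_zero (Θ : Module.End ℂ (ℂ ⊗[ℚ] V))
    (hΘ : ∀ k, Θ (e k) = ((2 * deg k - n : ℤ) : ℂ) • e k) (ρ : ℂ ≃+* ℂ) (x : Fin a → ℂ ⊗[ℚ] V)
    (hx : ∀ i, x i ∈ Module.End.eigenspace (z.baseChange ℂ) (ρ (wt (ε i).1))) :
    piTensorDerivation a Θ (A (PiTensorProduct.tprod ℂ x)) = 0 := by
  classical
  have hewt : ∀ k, e k ∈ Module.End.eigenspace (z.baseChange ℂ) (wt k) := fun k => (he k).1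
  rw [tprod_eq_sum_basis e x, map_sum, map_sum]
  refine Finset.sum_eq_zero fun yv _ => ?_
  rw [map_smul, map_smul]
  by_cases hwt : ∀ i, wt (yv i) = ρ (wt (ε i).1)
  · by_cases hinj : ∀ i j, (wt (ε i).1, ((ε i).2 : ℕ)) = (wt (ε j).1, ((ε j).2 : ℕ)) → yv i = yv j → i = j
    · -- injective on groups: the index fills the blocks, its `Θ`-degree is `Σ_λ w_λ μ(ρλ) = 0`
      rw [← antisym_piTensorDerivation_apply (fun i => (wt (ε i).1, ((ε i).2 : ℕ))) A hA,
        piTensorDerivation_tprod_of_diag Θ (fun i => e (yv i)) (fun i => ((2 * deg (yv i) - n : ℤ) : ℂ)) fun i => hΘ (yv i)]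
      have hsum : ∑ i, (((2 * deg (yv i) - n : ℤ) : ℂ)) = 0 := by
        have hcast : ∑ i, (((2 * deg (yv i) - n : ℤ) : ℂ)) = (((∑ i, (2 * deg (yv i) - n) : ℤ)) : ℂ) := by push_cast; rfl
        rw [hcast, Int.cast_eq_zero]
        set Y : (Σ k : Fin N, Fin (w (wt k))) → Fin N := fun s => yv (ε.symm s) with hY
        have h1 : ∀ s, wt (Y s) = ρ (wt s.1) := fun s => by
          rw [hY]; dsimp only; rw [hwt, Equiv.apply_symm_apply]
        have h2 : ∀ s s', wt s.1 = wt s'.1 → (s.2 : ℕ) = s'.2 → Y s = Y s' → s = s' := by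
          intro s s' hs1 hs2 hss'
          have := hinj (ε.symm s) (ε.symm s')
            (by rw [Equiv.apply_symm_apply, Equiv.apply_symm_apply]; exact Prod.ext hs1 hs2) hss'
          exact ε.symm.injective this
        have hm : ∀ μ, (Finset.univ.filter fun k => wt k = ρ μ).card = (Finset.univ.filter fun k => wt k = μ).card :=
          fun μ => card_filter_conj_eq e z wt hewt ρ μ
        calc ∑ i, (2 * deg (yv i) - n) = ∑ s, (2 * deg (Y s) - n) := by
              rw [← Equiv.sum_comp ε.symm (fun i => 2 * deg (yv i) - n)]
          _ = ∑ σ, (w (ρ.symm (wt σ)) : ℤ) * (2 * deg σ - n) :=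
              sum_comp_sigma_eq wt w ρ hm Y h1 h2 fun σ => 2 * deg σ - n
          _ = 0 := hw ρ
      rw [hsum, zero_smul, map_zero, smul_zero]
    · -- two slots of one group carry the same basis vector: alternation
      push Not at hinj
      obtain ⟨i, j, hg, hij, hne⟩ := hinj
      rw [antisym_tprod_eq_zero_of_eq (fun i => (wt (ε i).1, ((ε i).2 : ℕ))) A hA (fun i => e (yv i)) hne hg (by rw [hij]), map_zero, smul_zero]
  · -- the index misses a block: its coefficient vanishes
    push Not at hwt
    obtain ⟨i, hi⟩ := hwt
    have h0 : e.repr (x i) (yv i) = 0 :=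
      coord_eq_zero_of_mem_of_ne e wt (fun ν => Module.End.eigenspace (z.baseChange ℂ) ν)
        (Module.End.eigenspaces_iSupIndep (z.baseChange ℂ)) hewt (hx i) hi
    rw [Finset.prod_eq_zero (Finset.mem_univ i) h0, zero_smul]

/-! ### §4 The span of the Galois translates of the determinant tensors is stable under coordinate conjugation -/

include hA in
omit [Module.Finite ℚ V] [HodgeTensorFacts.{u, u}] in
/-- **Stability**: coordinate conjugation by `τ` in the rational tensor basis maps `A(⊗ᵢ xᵢ) ⊗ u₀` with `xᵢ ∈ Eig_{ρ(wt kᵢ)}(z_ℂ)` to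
`A(⊗ᵢ (τ ⊗ 1)xᵢ) ⊗ u₀` with `(τ ⊗ 1) xᵢ ∈ Eig_{τρ(wt kᵢ)}(z_ℂ)`, hence preserves the span of all such tensors.
[cite: Deligne1982HodgeCycles, I §3 Prop. 3.4, Example 3.7 (c) and §5] -/
theorem coordConj_mem_span_antisym {ι : Type*} [Fintype ι] [DecidableEq ι] (b : Module.Basis ι ℚ V) (τ : ℂ ≃+* ℂ)
    {T : hodgeTensorSpaceOver ℂ (ℂ ⊗[ℚ] V) a 0}
    (hT : T ∈ Submodule.span ℂ {T | ∃ (ρ : ℂ ≃+* ℂ) (x : Fin a → ℂ ⊗[ℚ] V),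
      (∀ i, x i ∈ Module.End.eigenspace (z.baseChange ℂ) (ρ (wt (ε i).1))) ∧
        T = A (PiTensorProduct.tprod ℂ x) ⊗ₜ[ℂ] PiTensorProduct.tprod ℂ (fun _ : Fin 0 => (0 : Module.Dual ℂ (ℂ ⊗[ℚ] V)))}) :
    ((Module.Basis.repr (hodgeTensorBasis (Algebra.TensorProduct.basis ℂ b) a 0)).toAddEquiv.trans
      ((Finsupp.mapRange.addEquiv (RingEquiv.toAddEquiv (τ))).trans
        (Module.Basis.repr (hodgeTensorBasis (Algebra.TensorProduct.basis ℂ b) a 0)).toAddEquiv.symm)) T ∈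
      Submodule.span ℂ {T | ∃ (ρ : ℂ ≃+* ℂ) (x : Fin a → ℂ ⊗[ℚ] V),
        (∀ i, x i ∈ Module.End.eigenspace (z.baseChange ℂ) (ρ (wt (ε i).1))) ∧
          T = A (PiTensorProduct.tprod ℂ x) ⊗ₜ[ℂ] PiTensorProduct.tprod ℂ (fun _ : Fin 0 => (0 : Module.Dual ℂ (ℂ ⊗[ℚ] V)))} := by
  classical
  have hcs := coordConj_smul' τ (hodgeTensorBasis (Algebra.TensorProduct.basis ℂ b) a 0)
  induction hT using Submodule.span_induction with
  | mem T hT =>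
    obtain ⟨ρ, x, hx, rfl⟩ := hT
    rw [coordConj_antisym_tprod_tmul b (fun i => (wt (ε i).1, ((ε i).2 : ℕ))) A hA τ x]
    refine Submodule.subset_span ⟨ρ.trans τ, fun i => (τ.toRingHom.toRatAlgHom.toLinearMap.rTensor V) (x i), fun i => ?_, rfl⟩
    have h := rTensor_mem_eigenspace_baseChange τ z (hx i)
    exact h
  | zero => rw [map_zero]; exact Submodule.zero_mem _
  | add T T' _ _ hT hT' => rw [map_add]; exact Submodule.add_mem _ hT hT'
  | smul c T _ hT => rw [hcs]; exact Submodule.smul_mem _ _ hT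

/-! ### §5 The engine: `Σ_λ w_λ tr(y_ℂ | V_λ) = 0` for `y ∈ 𝔥` commuting with `z` -/

include he hw hA in
/-- **The engine of the centre theorem.**  `H` a Hodge structure, `z` a rational endomorphism with a basis `e_k ∈ Eig_{wt k}(z_ℂ) ∩
V^{deg k, n − deg k}` of `V_ℂ`, `w : ℂ → ℕ` multiplicities whose every `Aut(ℂ)`-translate is `Θ`-orthogonal
(`Σ_k w(ρ⁻¹ wt k) (2 deg k − n) = 0`, i.e. `Σ_λ w_λ μ(ρλ) = 0`).  Then for every `y` in the Hodge Lie algebra commuting with `z`: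
`Σ_k w(wt k) e^*_k(y_ℂ e_k) = 0`, i.e. `Σ_λ w_λ tr(y_ℂ|V_λ) = 0` — the determinant tensor `⊗_λ (det V_λ)^{⊗ w_λ}` is a complex
combination of rational Hodge classes (§2–§4), so `ρ(y_ℂ)` kills it, and `ρ(y_ℂ)` acts on it by `Σ_λ w_λ tr(y_ℂ|V_λ)` (part 1).
[cite: Deligne1982HodgeCycles, I §3 Prop. 3.4, Example 3.7 (c) and §5] [cite: MoonenZarhin1999LowDim, §3 (3.1)] -/
theorem sum_mul_repr_baseChange_eq_zero_of_mem_hodgeLie_aux {y : Module.End ℚ V} (hy : y ∈ H.hodgeLie) (hyz : y * z = z * y) :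
    ∑ i : Fin a, e.repr ((y.baseChange ℂ) (e (ε i).1)) (ε i).1 = 0 := by
  classical
  have hewt : ∀ k, e k ∈ Module.End.eigenspace (z.baseChange ℂ) (wt k) := fun k => (he k).1
  have hep : ∀ k, e k ∈ H.piece (deg k) (n - deg k) := fun k => (he k).2
  set b := Module.finBasis ℚ V with hb
  -- the operator `Θ`, diagonal in `e`
  set Θ : Module.End ℂ (ℂ ⊗[ℚ] V) := e.constr ℂ fun k => ((2 * deg k - n : ℤ) : ℂ) • e k with hΘdef
  have hΘ : ∀ k, Θ (e k) = ((2 * deg k - n : ℤ) : ℂ) • e k := fun k => by rw [hΘdef, Module.Basis.constr_basis]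
  -- the subspace `D`
  set u₀ : ⨂[ℂ]^0 (Module.Dual ℂ (ℂ ⊗[ℚ] V)) :=
    PiTensorProduct.tprod ℂ (fun _ : Fin 0 => (0 : Module.Dual ℂ (ℂ ⊗[ℚ] V))) with hu₀
  set G : Set (hodgeTensorSpaceOver ℂ (ℂ ⊗[ℚ] V) a 0) := {T | ∃ (ρ : ℂ ≃+* ℂ) (x : Fin a → ℂ ⊗[ℚ] V),
      (∀ i, x i ∈ Module.End.eigenspace (z.baseChange ℂ) (ρ (wt (ε i).1))) ∧
        T = A (PiTensorProduct.tprod ℂ x) ⊗ₜ[ℂ] PiTensorProduct.tprod ℂ (fun _ : Fin 0 => (0 : Module.Dual ℂ (ℂ ⊗[ℚ] V)))}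
    with hG
  set D := Submodule.span ℂ G with hD
  -- `ρ(Θ)` kills `D`
  have hΘD : ∀ T ∈ D, tensorDerivation a 0 Θ T = 0 := by
    intro T hT
    rw [← LinearMap.mem_ker]
    revert hT T
    rw [← SetLike.le_def, hD, Submodule.span_le]
    rintro _ ⟨ρ, x, hx, rfl⟩
    rw [SetLike.mem_coe, LinearMap.mem_ker, tensorDerivation_zero_tmul,
      piTensorDerivation_theta_antisym_tprod_eq_zero H e wt deg he w hw ε A hA Θ hΘ ρ x hx, TensorProduct.zero_tmul]
  -- `D` is stable under coordinate conjugation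
  have hstab : ∀ (τ : ℂ ≃+* ℂ), ∀ T ∈ D,
      ((Module.Basis.repr (hodgeTensorBasis (Algebra.TensorProduct.basis ℂ b) a 0)).toAddEquiv.trans
        ((Finsupp.mapRange.addEquiv (RingEquiv.toAddEquiv (τ))).trans
          (Module.Basis.repr (hodgeTensorBasis (Algebra.TensorProduct.basis ℂ b) a 0)).toAddEquiv.symm)) T ∈ D :=
    fun τ T hT => coordConj_mem_span_antisym (wt := wt) (w := w) (ε := ε) (A := A) hA b τ hT
  -- hence `ρ(y_ℂ)` kills `D`, in particular the determinant tensor `T₀ = A(⊗ᵢ e_{kᵢ}) ⊗ u₀`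
  have hkill := tensorDerivation_baseChange_eq_zero_of_coordConj_stable H e deg hep Θ hΘ b D hstab hΘD hy
  set T₀ := A (PiTensorProduct.tprod ℂ fun i => e (ε i).1) ⊗ₜ[ℂ] u₀ with hT₀
  have hT₀D : T₀ ∈ D := by
    refine Submodule.subset_span ⟨RingEquiv.refl ℂ, fun i => e (ε i).1, fun i => ?_, rfl⟩
    exact hewt _
  have h0 := hkill T₀ hT₀D
  -- `ρ(y_ℂ) T₀ = (Σᵢ e^*_{kᵢ}(y_ℂ e_{kᵢ})) T₀` and `T₀ ≠ 0`
  have hyz' : ∀ v, (z.baseChange ℂ) ((y.baseChange ℂ) v) = (y.baseChange ℂ) ((z.baseChange ℂ) v) := by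
    intro v
    rw [← Module.End.mul_apply, ← Module.End.mul_apply, ← LinearMap.baseChange_mul, ← LinearMap.baseChange_mul, hyz]
  have hY : ∀ σ σ', wt σ' ≠ wt σ → e.repr ((y.baseChange ℂ) (e σ)) σ' = 0 := by
    intro σ σ' hne
    have hmem : (y.baseChange ℂ) (e σ) ∈ Module.End.eigenspace (z.baseChange ℂ) (wt σ) := by
      rw [Module.End.mem_eigenspace_iff, hyz', Module.End.mem_eigenspace_iff.1 (hewt σ), map_smul]
    exact coord_eq_zero_of_mem_of_ne e wt (fun ν => Module.End.eigenspace (z.baseChange ℂ) ν)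
      (Module.End.eigenspaces_iSupIndep (z.baseChange ℂ)) hewt hmem hne
  have hext : ∀ s s' : (Σ k : Fin N, Fin (w (wt k))), s.1 = s'.1 → (s.2 : ℕ) = s'.2 → s = s' := by
    rintro ⟨k, j⟩ ⟨k', j'⟩ hk hj
    dsimp only at hk hj
    subst hk
    simp only [Sigma.mk.injEq, heq_eq_eq, true_and]
    exact Fin.ext hj
  have hsurj : ∀ (i : Fin a) (σ : Fin N), wt σ = wt (ε i).1 →
      ∃ j, (wt (ε j).1, ((ε j).2 : ℕ)) = (wt (ε i).1, ((ε i).2 : ℕ)) ∧ (ε j).1 = σ := by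
    intro i σ hσ
    have hlt : ((ε i).2 : ℕ) < w (wt σ) := by rw [hσ]; exact (ε i).2.isLt
    refine ⟨ε.symm ⟨σ, ⟨(ε i).2, hlt⟩⟩, ?_, ?_⟩
    · rw [Equiv.apply_symm_apply]
      exact Prod.ext hσ rfl
    · rw [Equiv.apply_symm_apply]
  have hinj : ∀ i j : Fin a, (wt (ε i).1, ((ε i).2 : ℕ)) = (wt (ε j).1, ((ε j).2 : ℕ)) → (ε i).1 = (ε j).1 → i = j := by
    intro i j hg h1
    exact ε.injective (hext _ _ h1 (Prod.ext_iff.1 hg).2)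
  have hρT₀ : tensorDerivation a 0 (y.baseChange ℂ) T₀ = (∑ i, e.repr ((y.baseChange ℂ) (e (ε i).1)) (ε i).1) • T₀ := by
    rw [hT₀, tensorDerivation_zero_tmul,
      piTensorDerivation_antisym_tprod_basis (fun i => (wt (ε i).1, ((ε i).2 : ℕ))) A hA e wt (fun i => (ε i).1) hsurj hY,
      TensorProduct.smul_tmul']
  have hT₀ne : T₀ ≠ 0 := by
    intro h
    exact antisym_tprod_basis_ne_zero (fun i => (wt (ε i).1, ((ε i).2 : ℕ))) A hA e (fun i => (ε i).1) hinj
      (eq_zero_of_tmul_tprod_fin_zero_eq_zero _ _ h)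
  rw [hρT₀] at h0
  exact (smul_eq_zero.1 h0).resolve_right hT₀ne

end Engine

/-- **THE ENGINE (standalone form).**  For a Hodge structure `H`, a rational endomorphism `z` and a basis `e_k ∈ Eig_{wt k}(z_ℂ) ∩
V^{deg k, n−deg k}` of `V_ℂ`: if the multiplicities `w : ℂ → ℕ` satisfy `Σ_k w(ρ⁻¹ wt k)(2 deg k − n) = 0` for every `ρ ∈ Aut(ℂ)`,
then `Σ_k w(wt k) · e^*_k(y_ℂ e_k) = 0` (`= Σ_λ w_λ tr(y_ℂ | Eig_λ)`) for every `y` in the Hodge Lie algebra commuting with `z`.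
[cite: Deligne1982HodgeCycles, I §3 Prop. 3.4, Example 3.7 (c) and §5] [cite: MoonenZarhin1999LowDim, §3 (3.1)] -/
theorem sum_mul_repr_baseChange_eq_zero_of_mem_hodgeLie (H : HodgeStructure V n) {z : Module.End ℚ V} {N : ℕ}
    (e : Module.Basis (Fin N) ℂ (ℂ ⊗[ℚ] V)) (wt : Fin N → ℂ) (deg : Fin N → ℤ)
    (he : ∀ k, e k ∈ Module.End.eigenspace (z.baseChange ℂ) (wt k) ⊓ H.piece (deg k) (n - deg k))
    (w : ℂ → ℕ) (hw : ∀ ρ : ℂ ≃+* ℂ, ∑ k, (w (ρ.symm (wt k)) : ℤ) * (2 * deg k - n) = 0)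
    {y : Module.End ℚ V} (hy : y ∈ H.hodgeLie) (hyz : y * z = z * y) :
    ∑ k, (w (wt k) : ℂ) * e.repr ((y.baseChange ℂ) (e k)) k = 0 := by
  classical
  set ε := (Fintype.equivFin (Σ k : Fin N, Fin (w (wt k)))).symm with hε
  have h := sum_mul_repr_baseChange_eq_zero_of_mem_hodgeLie_aux H e wt deg he w hw ε _ rfl hy hyz
  rw [← Equiv.sum_comp ε.symm (fun i => e.repr ((y.baseChange ℂ) (e (ε i).1)) (ε i).1)] at h
  simp only [Equiv.apply_symm_apply] at h
  rw [Fintype.sum_sigma] at h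
  simpa only [Finset.sum_const, Finset.card_univ, Fintype.card_fin, nsmul_eq_mul] using h

end HodgeStructure

end Literature.AlgebraicGeometry.Motives

end
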